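import Literature.IUT.HodgeArakelov.BadPrimeGaussianMonoidsCor36GenuineRecordThirdDisplay
import Literature.IUT.HodgeArakelov.ThetaEvaluationSettingModelAssembly
import Literature.IUT.HodgeArakelov.EtaleThetaDataOfSettingInversion
import Literature.IUT.HodgeArakelov.IotaInvariantThetaInftyModel

/-!
# [IUTchII] Cor 3.5 (ii) at the genuine `θ_env` data: the junction input `horb` ("`θ^ι_env(𝕄_*)` is ONE `M^×_TM`-orbit")
# DERIVED for the pointed-inversion PAIR action from the class-level [EtTh] Prop 1.4 inputs of Prop 2.2 (ii)

S. Mochizuki, *Inter-universal Teichmüller theory II*, kurims Dec-2020 manuscript: Prop 2.2 (ii) p. 66 («… together with the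
condition of invariance with respect to `ι` … determines a specific `μ_{2l}`-orbit `θ^ι(Π_v) ⊆ θ(Π_v)` within the unique
`{(l·ℤ)×μ_{2l}}`-orbit contained in the set `θ(Π_v)`»), Cor 1.12 (i) p. 57 (the "action up to torsion" convention), Cor 2.8 (i)
p. 82, Prop 3.1 (i) p. 87, Cor 3.5 (ii) p. 95 [cite: Mochizuki2012, Prop 2.2 (ii) p.66]; [EtTh] Prop 1.4 (i)–(iii) pp. 20–22,
Def 2.7 p. 41 (refereed). Claim key `Mochizuki2012` DISPUTED (D-0012). PROOF-ONLY companion (abc-iut cell, layer L6, seat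
abc-iut-w4-d004 gen 4; node **IUTchII:Cor3.5(ii)**, restriction-ISO clause, sub-DAG row Cor-35.ii.r12; row «COR35ii-HORB-GENUINE», file 1/2).
NO definition, NO `Prop` fact, NO instance; nothing landed is restated — abc-iut-w4-d010's Prop 2.2 (ii) model lemmas
(`orbitOne_desc_of_sign`, `hrev_of_transport`, `conj_rootLiftClass_of_mem_GtpY`, `eq_zero_of_invariant_translate`,
`isOfFinAddOrder_iota_sub_iff_of_theta`), abc-iut-w5-d072's pair actions (`pairRho`, `pairRhoLim`, `toLim_pairRho`,
`pairRho_h1Top_symm`), abc-iut-w5-d187's inflation–restriction (`toLim_top_ker_torsion_of_forall_fixed_eq_one`,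
`EtaleThetaData.isOfFinAddOrder_of_toLim`) and abc-iut-w5-d192's `horb_toRecord_family_of_orbit` are CONSUMED BY NAME.

WHY THIS FILE. After abc-iut-w4-d004 gen 3 (p432177 / p434055) the Cor 3.5 (ii) restriction isomorphism at the genuine `θ_env`
data of `X̲̲_K` holds for ANY family of inversion actions `iota` with every [IUTchII] §3 junction hypothesis derived, EXCEPT the
binder `horb` («`θ^{i₀}_env(𝕄_*)` is a single `M^×_TM`-orbit»), reduced (`ThetaEnvData.horb_toRecord_of_orbit`, abc-iut-w5-d192
`horb_toRecord_family_of_orbit`) to the RAW orbit clause of Prop 2.2 (ii) read in the limit: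
`horbit : any two ι-invariants up to torsion of θ(Π) in lim_J differ by a torsion class`. In the tree the `μ_{2l}`-orbit clause is
available only INSIDE abc-iut-w4-d010's `prop22_ii'_of_translates`, whose conclusion `Prop22_ii' Dec = Nonempty (IotaInvariantTheta' Dec)`
hides WHICH action `ι` it is about — so no consumer can cite it for a GIVEN action. Here it is stated and proved FOR A GIVEN
ADDITIVE AUTOMORPHISM, in three layers:
* §1 `EtaleThetaData.thetaIota_orbit_of_translates` (any Prop 1.4 output `D`, any `ρ : H¹ ≃+ H¹`): from the translate
  description of the orbit (`hdesc`), «`ρ` reverses the translates up to torsion» (`hrev`) and «distinct translates differ by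
  non-torsion classes» (`hfree`) — the very inputs of `prop22_ii'_of_translates` — any two `ρ`-invariants up to torsion of `θ(Π)`
  differ by a `2l`-torsion class; `…_lim_of_translates` / `ThetaEnvData.horbit_thetaIotaLim_of_translates`: the same READ IN
  THE LIMIT for a compatible `e : lim ≃+ lim`, given that `Ker(H¹ → lim_J)` is torsion (`hker`, inflation–restriction);
* §2 AT THE MODEL `Π_v := Π^tp_{X̲̲}` (abc-iut-L6-t1's `etaleThetaDataOfSetting'`) for the pointed-inversion PAIR `(α, β)`
  (`ρ := pairRho`, `e := pairRhoLim`): `EtaleThetaDataOfSetting.thetaIota_orbit_pairRho` from EXACTLY the residual (R1)(R2)(R3) of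
  abc-iut-w4-d010's closing theorem `prop22_ii'_model` (GAP-LEDGER D-G-w4d010-2d): the pair with `toLZ (α γ) = −1`, the class-level
  sign `hsign` and root `hroot` statements ([EtTh] Prop 1.4 (ii)) and `hfree` ([EtTh] Prop 1.4 (i)/(iii));
* §3 AT THE GENUINE `θ_env` DATA `EtaleLevels.thetaEnvData C …` (abc-iut-w4-d030): `EtaleLevels.horbit_thetaEnvData_pairRhoLim`
  (inputs (R1)–(R3) + `hker`, or + the cyclotome fixed-point fact `hfix` of abc-iut-w5-d187/w4-d043 via
  `horbit_thetaEnvData_pairRhoLim_of_fixed`), then `horb_toRecord_pairRhoLim` — the Cor 3.5 (ii) binder `horb` at the genuine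
  record `(thetaEnvData …).toRecord (h1LimConjMulAut …) (h1LimKummerOn c hA hfi O) iota` for ANY inversion family whose
  `i₀`-th member IS the pair action (`iota i₀ = pairRhoLim C α β …`: the print-faithful family of `Π^tp_{X̲̲}`-conjugates of one
  pointed inversion has this shape, abc-iut-w5-d169 `inversionOrbit`). The capstone — [IUTchII] Cor 3.5 (ii)
  «`Ψ^ι_env(M^Θ_*) ⥲ Ψ_ξ(M^Θ_*)`» at the genuine data over `ℚ̄_pˣ` with `horb` DISCHARGED,
  `EtaleLevels.exists_unique_restrictionIso'_toRecord_padic_of_evaluation_pairRhoLim` — is file 2/2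
  (`BadPrimeGaussianMonoidsGenuineRecordRestrictionIsoPair.lean`).
RESIDUAL of node IUTchII:Cor3.5(ii) (restriction-ISO clause) after this file ⊆ {the Prop 2.2 (ii) model residual (R1)(R2)(R3) of
`prop22_ii'_model` (already on the books), `hfix`/`hker`, `μ ⊆ O` (`hOtors`), the evaluation-sections / presentation / VALUES data of
[EtTh] §1 (E2, L2-side), the model data (`c`, `c₀`)} — no junction hypothesis of [IUTchII] §3 and no raw §2 orbit clause remains.
HONEST FRAMING: composition of landed theorems over the cell's own objects; nothing disputed is asserted; no side is taken on
[IUTchIII] Cor 3.12; typed ≠ proved ≠ endorsed.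
-/

noncomputable section

namespace Literature.IUT.HodgeArakelov

universe u

/-! ### §1. The `μ_{2l}`-orbit clause of [IUTchII] Prop 2.2 (ii) FOR A GIVEN ACTION (abstract Prop 1.4 output) -/

namespace EtaleThetaData

variable {S : ThetaSetting.{u}} {P : TopGroup.{u}} (D : EtaleThetaData S P)

/-- **`θ^ρ(Π) ≠ ∅` for a given action**: if `ρ` reverses the translates up to torsion (`hrev`), the reciprocal `−τ 0` of the
standard translate `τ 0 ∈ η̈^{Θ,l·ℤ×μ_2}` is a class of `θ(Π)` that is `ρ`-invariant up to torsion ([IUTchII] Prop 2.2 (ii):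
«the vertex labeled `0` is fixed», Rmk 2.1.1 (ii)). [cite: Mochizuki2012, Prop 2.2 (ii) p.66] -/
theorem thetaIota_nonempty_of_translates (ρ : D.coh.H1 ⊤ ≃+ D.coh.H1 ⊤) (τ : ℤ → D.coh.H1 ⊤) (hτ0 : τ 0 ∈ D.orbit)
    (hrev : ∀ n : ℤ, IsOfFinAddOrder (ρ (τ n) - τ (-n))) :
    ∃ t ∈ D.theta, IsOfFinAddOrder (ρ t - t) := by
  refine ⟨-τ 0, D.neg_mem_theta hτ0, ?_⟩
  have hstd : IsOfFinAddOrder (ρ (τ 0) - τ 0) := by simpa using hrev 0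
  have h : ρ (-τ 0) - -τ 0 = -(ρ (τ 0) - τ 0) := by rw [map_neg]; abel
  rw [h]
  exact hstd.neg

/-- **[IUTchII] Prop 2.2 (ii), the `μ_{2l}`-orbit clause FOR A GIVEN ADDITIVE AUTOMORPHISM `ρ` of `H¹(Π_Ÿ(Π), (l·Δ_Θ)(Π))`**
(kurims p. 66: «determines a specific `μ_{2l}`-orbit `θ^ι(Π_v) ⊆ θ(Π_v)`»): if the orbit `η̈^{Θ,l·ℤ×μ_2}` consists of the
translates `τ n` up to `2`-torsion classes (`hdesc`, deck translations × the sign of `Θ̈`), `ρ` carries `τ n` to `τ(−n)` up to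
torsion (`hrev`, [EtTh] Prop 1.4 (ii); `ι` reverses the `ℤ`-torsor of components) and distinct translates differ by non-torsion
classes (`hfree`, [EtTh] Prop 1.4 (i)/(iii)), then ANY TWO classes of `θ(Π)` that are `ρ`-invariant up to torsion differ by a
`2l`-torsion class. (The argument of abc-iut-w4-d010's `prop22_ii'_of_translates`, whose conclusion `Nonempty (IotaInvariantTheta' _)`
does not name the action; stated here for the given `ρ` so that consumers can cite it.) [cite: Mochizuki2012, Prop 2.2 (ii) p.66] -/
theorem thetaIota_orbit_of_translates (ρ : D.coh.H1 ⊤ ≃+ D.coh.H1 ⊤) (τ : ℤ → D.coh.H1 ⊤)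
    (hdesc : ∀ o ∈ D.orbit, ∃ (n : ℤ) (c : D.coh.H1 ⊤), 2 • c = 0 ∧ o = τ n + c)
    (hrev : ∀ n : ℤ, IsOfFinAddOrder (ρ (τ n) - τ (-n)))
    (hfree : ∀ m n : ℤ, IsOfFinAddOrder (τ m - τ n) → m = n) :
    ∀ t ∈ D.theta, ∀ t' ∈ D.theta, IsOfFinAddOrder (ρ t - t) → IsOfFinAddOrder (ρ t' - t') →
      (2 * S.l) • (t' - t) = 0 := by
  have hl : 0 < S.l := S.l_prime.pos
  -- every `ρ`-invariant (up to torsion) orbit member is `τ 0 + c` with `2·c = 0`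
  have hmem : ∀ o ∈ D.orbit, IsOfFinAddOrder (ρ o - o) → ∃ c, 2 • c = 0 ∧ o = τ 0 + c := by
    intro o ho hinv
    obtain ⟨n, c, hc, rfl⟩ := hdesc o ho
    have hn : n = 0 := eq_zero_of_invariant_translate ρ τ hrev hfree hc hinv
    subst hn
    exact ⟨c, hc, rfl⟩
  intro t ht t' ht' hinv hinv'
  have ht₀ := ht
  have ht₀' := ht'
  rw [D.theta_eq] at ht₀ ht₀'
  obtain ⟨o, ho, hlo⟩ := ht₀
  obtain ⟨o', ho', hlo'⟩ := ht₀'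
  have hio : IsOfFinAddOrder (ρ o - o) := (isOfFinAddOrder_iota_sub_iff_of_theta ρ hl hlo).mp hinv
  have hio' : IsOfFinAddOrder (ρ o' - o') := (isOfFinAddOrder_iota_sub_iff_of_theta ρ hl hlo').mp hinv'
  obtain ⟨c, hc, rfl⟩ := hmem o ho hio
  obtain ⟨c', hc', rfl⟩ := hmem o' ho' hio'
  have h1 : (2 * S.l) • ((t' + (τ 0 + c')) - (t + (τ 0 + c))) = 0 := by
    rw [smul_sub, mul_nsmul', hlo', mul_nsmul', hlo, sub_self]
  have h2 : (2 * S.l) • (c' - c) = 0 := by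
    rw [smul_sub, mul_nsmul, hc', mul_nsmul, hc, sub_self]
  have hsplit : t' - t = ((t' + (τ 0 + c')) - (t + (τ 0 + c))) - (c' - c) := by abel
  rw [hsplit, smul_sub, h1, h2, sub_self]

/-- **The `μ_{2l}`-orbit clause READ IN THE LIMIT** ([IUTchII] Cor 1.12 (i) convention, Cor 2.8 (i) / Prop 3.1 (i): the
`ι`-invariants up to torsion of the image of `θ(Π)` in `lim_J H¹(Π_Ÿ(Π)|_J, (l·Δ_Θ)(Π))`): for an additive automorphism `e` of
the limit compatible with `ρ` through `toLim` (`hcompat`) and `Ker(H¹(Π_Ÿ(Π), ·) → lim_J) ⊆ torsion` (`hker`,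
inflation–restriction), any two `e`-invariants up to torsion of `toLim(θ(Π))` differ by a torsion class.
[cite: Mochizuki2012, Cor 2.8 (i) p.82] -/
theorem thetaIota_orbit_lim_of_translates (ρ : D.coh.H1 ⊤ ≃+ D.coh.H1 ⊤) (e : D.coh.lim ≃+ D.coh.lim)
    (hcompat : ∀ x, D.coh.toLim ⊤ (ρ x) = e (D.coh.toLim ⊤ x))
    (hker : ∀ y : D.coh.H1 ⊤, D.coh.toLim ⊤ y = 0 → IsOfFinAddOrder y)
    (τ : ℤ → D.coh.H1 ⊤)
    (hdesc : ∀ o ∈ D.orbit, ∃ (n : ℤ) (c : D.coh.H1 ⊤), 2 • c = 0 ∧ o = τ n + c)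
    (hrev : ∀ n : ℤ, IsOfFinAddOrder (ρ (τ n) - τ (-n)))
    (hfree : ∀ m n : ℤ, IsOfFinAddOrder (τ m - τ n) → m = n) :
    ∀ x ∈ D.coh.toLim ⊤ '' D.theta, ∀ x' ∈ D.coh.toLim ⊤ '' D.theta,
      IsOfFinAddOrder (e x - x) → IsOfFinAddOrder (e x' - x') → IsOfFinAddOrder (x' - x) := by
  rintro _ ⟨t, ht, rfl⟩ _ ⟨t', ht', rfl⟩ hinv hinv'
  -- descend the invariance from the limit to `H¹` through `hker`
  have pull : ∀ {s : D.coh.H1 ⊤}, IsOfFinAddOrder (e (D.coh.toLim ⊤ s) - D.coh.toLim ⊤ s) →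
      IsOfFinAddOrder (ρ s - s) := by
    intro s hs
    rw [← hcompat, ← map_sub] at hs
    exact D.isOfFinAddOrder_of_toLim hker hs
  have h := D.thetaIota_orbit_of_translates ρ τ hdesc hrev hfree t ht t' ht' (pull hinv) (pull hinv')
  have hfin : IsOfFinAddOrder (t' - t) :=
    isOfFinAddOrder_iff_nsmul_eq_zero.mpr ⟨2 * S.l, Nat.mul_pos two_pos S.l_prime.pos, h⟩
  have himg := (D.coh.toLim ⊤).isOfFinAddOrder hfin
  rwa [map_sub] at himg

end EtaleThetaData

namespace ThetaEnvData

variable {S : ThetaSetting.{u}} {F : ModelFamily S} {Sys : MonoThetaProjSystem F} (T : ThetaEnvData Sys)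

/-- **`horbit` for a `θ_env` datum and a GIVEN action** ([IUTchII] Prop 3.1 (i) p. 87 / Cor 2.8 (i) p. 82: the raw orbit clause
«`θ^ι(Π_v)` is a `μ_{2l}`-orbit» read in `lim_J`): any two members of `T.thetaIotaLim e` (abc-iut-w4-d019's `θ^ι(Π)` in the limit
for the action `e`) differ by a torsion class, given the translate inputs for a compatible `ρ` on `H¹` and `hker` — exactly the
hypothesis `horbit` of abc-iut-w4-d004's `ThetaEnvData.horb_toRecord_of_orbit` / abc-iut-w5-d192's `horb_toRecord_family_of_orbit`.
[cite: Mochizuki2012, Prop 3.1 (i) p.87] -/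
theorem horbit_thetaIotaLim_of_translates (ρ : T.D.coh.H1 ⊤ ≃+ T.D.coh.H1 ⊤) (e : T.D.coh.lim ≃+ T.D.coh.lim)
    (hcompat : ∀ x, T.D.coh.toLim ⊤ (ρ x) = e (T.D.coh.toLim ⊤ x))
    (hker : ∀ y : T.D.coh.H1 ⊤, T.D.coh.toLim ⊤ y = 0 → IsOfFinAddOrder y)
    (τ : ℤ → T.D.coh.H1 ⊤)
    (hdesc : ∀ o ∈ T.D.orbit, ∃ (n : ℤ) (c : T.D.coh.H1 ⊤), 2 • c = 0 ∧ o = τ n + c)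
    (hrev : ∀ n : ℤ, IsOfFinAddOrder (ρ (τ n) - τ (-n)))
    (hfree : ∀ m n : ℤ, IsOfFinAddOrder (τ m - τ n) → m = n) :
    ∀ x ∈ T.thetaIotaLim e, ∀ x' ∈ T.thetaIotaLim e, IsOfFinAddOrder (x' - x) := by
  intro x hx x' hx'
  rw [T.mem_thetaIotaLim_iff] at hx hx'
  exact T.D.thetaIota_orbit_lim_of_translates ρ e hcompat hker τ hdesc hrev hfree x hx.1 x' hx'.1 hx.2 hx'.2

end ThetaEnvData

/-! ### §2. At the MODEL `Π_v := Π^tp_{X̲̲}` for the pointed-inversion pair `(α, β)`: `ρ := pairRho`, `e := pairRhoLim` -/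

namespace EtaleThetaDataOfSetting

open Literature.AnabelianGeometry.EtaleTheta (ContH1)

variable {p : ℕ} [Fact p.Prime] {D : Literature.AnabelianGeometry.EtaleTheta.ThetaSetting p}
  {E : D.EtaleThetaData} {l : ℕ} (C : E.DoubleUnderline l) [hN : (PiYdd C).Normal]

/-- `ι` (through the transport `h1TopAut` of the pair `(α, β)`) moves the root class `η̲̈^Θ` by a class of FINITE ORDER, as soon
as it carries it to a `Π^tp_{Y̲̲}`-conjugate (`hroot`, [EtTh] Prop 1.4 (ii) at the class level) — the step of abc-iut-w4-d010's
`prop22_ii'_model` (via `conj_rootLiftClass_of_mem_GtpY` and the class-level sign `hsign`), isolated for reuse.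
[cite: MochizukiEtTh2009, Def 2.7 p.41] -/
theorem hιsign_of_hroot (hS : D.Sec2Hyps)
    (α : (Pi C) ≃ₜ* (Pi C)) (β : D.GtpTheta ≃ₜ* D.GtpTheta) (hφ : ∀ g, β (phi C g) = phi C (α g))
    (hA : ∀ a : D.GtpTheta, a ∈ D.lDeltaTheta l → β a ∈ D.lDeltaTheta l)
    (hH : ∀ x, x ∈ PiYdd C ↔ α x ∈ PiYdd C)
    (ε : Pi C) (hε₁ : (ε : D.PiTemp) ∈ D.GtpY) (hε₂ : (ε : D.PiTemp) ∉ D.GtpYdd)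
    (hsign : ∃ κ : ContH1 (phi C) (D.lDeltaTheta l) (PiYdd C ⊓ ⊤), κ ^ 2 = 1 ∧
      ContH1.conj (phi C) (D.lDeltaTheta l) ε (rootLiftClass C) = rootLiftClass C * κ)
    (hroot : ∃ τ₀ : Pi C, (τ₀ : D.PiTemp) ∈ D.GtpY ∧
      h1TopAut (phi C) (D.lDeltaTheta l) (PiYdd C) α β hφ hA hH (rootLiftClass C) =
        ContH1.conj (phi C) (D.lDeltaTheta l) τ₀ (rootLiftClass C)) :
    ∃ κ' : ContH1 (phi C) (D.lDeltaTheta l) (PiYdd C ⊓ ⊤), IsOfFinOrder κ' ∧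
      h1TopAut (phi C) (D.lDeltaTheta l) (PiYdd C) α β hφ hA hH (rootLiftClass C) = rootLiftClass C * κ' := by
  obtain ⟨τ₀, hτ₀Y, hτ₀⟩ := hroot
  obtain ⟨t, ht, h⟩ := conj_rootLiftClass_of_mem_GtpY C hS ε hε₁ hε₂ hsign τ₀ hτ₀Y
  exact ⟨t, ht, hτ₀.trans h⟩

/-- **[IUTchII] Prop 2.2 (ii), the `μ_{2l}`-orbit clause AT THE MODEL for THE pair action `ρ := pairRho C α β …`** (kurims p. 66):
over abc-iut-L6-t1's Prop 1.4 output `etaleThetaDataOfSetting' C …` (REAL continuous cohomology of `Π^tp_{Ÿ̲̲}` with coefficients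
`l·Δ_Θ`), any two classes of `θ(Π_v)` invariant up to torsion under abc-iut-w5-d072's `pairRho` of an automorphism pair `(α, β)`
— compatible with `φ` and `l·Δ_Θ`, stabilising `Π^tp_{Ÿ̲̲}`, REVERSING the `ℤ`-torsor (`toLZ (α γ) = −1`, Rmk 2.1.1 (i)) — differ by
a `2l`-torsion class, given EXACTLY the class-level residual of abc-iut-w4-d010's `prop22_ii'_model`: (R2) `hsign`, `hroot` ([EtTh]
Prop 1.4 (ii)), (R3) `hfree` ([EtTh] Prop 1.4 (i)/(iii)). The translates `τ n = γⁿ·η̲̈^Θ`, `hdesc` (`orbitOne_desc_of_sign`) and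
`hrev` (`hrev_of_transport`) are abc-iut-w4-d010's theorems. [cite: Mochizuki2012, Prop 2.2 (ii) p.66] -/
theorem thetaIota_orbit_pairRho (hC : D.Compat) (hS : D.Sec2Hyps) (hchar : PiYddCharacteristic C)
    (S : ThetaSetting.{0}) (eS : (Pi C) ≃ₜ* S.PiX) (hl : S.l = l)
    (α : (Pi C) ≃ₜ* (Pi C)) (β : D.GtpTheta ≃ₜ* D.GtpTheta) (hφ : ∀ g, β (phi C g) = phi C (α g))
    (hA : ∀ a : D.GtpTheta, a ∈ D.lDeltaTheta l ↔ β a ∈ D.lDeltaTheta l)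
    (hH : ∀ x, x ∈ PiYdd C ↔ α x ∈ PiYdd C)
    (γ ε : Pi C) (hγ : C.toLZ γ = Multiplicative.ofAdd 1) (hε₁ : (ε : D.PiTemp) ∈ D.GtpY)
    (hε₂ : (ε : D.PiTemp) ∉ D.GtpYdd) (hαγ : C.toLZ (α γ) = Multiplicative.ofAdd (-1))
    (hsign : ∃ κ : ContH1 (phi C) (D.lDeltaTheta l) (PiYdd C ⊓ ⊤), κ ^ 2 = 1 ∧
      ContH1.conj (phi C) (D.lDeltaTheta l) ε (rootLiftClass C) = rootLiftClass C * κ)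
    (hroot : ∃ τ₀ : Pi C, (τ₀ : D.PiTemp) ∈ D.GtpY ∧
      h1TopAut (phi C) (D.lDeltaTheta l) (PiYdd C) α β hφ (fun a ha => (hA a).mp ha) hH (rootLiftClass C) =
        ContH1.conj (phi C) (D.lDeltaTheta l) τ₀ (rootLiftClass C))
    (hfree : ∀ m n : ℤ, IsOfFinAddOrder
      ((h1Top C).symm (Additive.ofMul (ContH1.conj (phi C) (D.lDeltaTheta l) (γ ^ m) (rootLiftClass C))) -
        (h1Top C).symm (Additive.ofMul (ContH1.conj (phi C) (D.lDeltaTheta l) (γ ^ n) (rootLiftClass C)))) →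
      m = n) :
    ∀ t t' : (coh C).H1 ⊤, t ∈ (etaleThetaDataOfSetting' C hC hS hchar S eS hl).theta →
      t' ∈ (etaleThetaDataOfSetting' C hC hS hchar S eS hl).theta →
        IsOfFinAddOrder (pairRho C α β hφ hA hH t - t) → IsOfFinAddOrder (pairRho C α β hφ hA hH t' - t') →
          (2 * l) • (t' - t) = 0 := by
  intro t t' ht ht' hinv hinv'
  have h := (etaleThetaDataOfSetting' C hC hS hchar S eS hl).thetaIota_orbit_of_translates (pairRho C α β hφ hA hH)
    (fun n => (h1Top C).symm (Additive.ofMul (ContH1.conj (phi C) (D.lDeltaTheta l) (γ ^ n) (rootLiftClass C))))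
    (orbitOne_desc_of_sign C hC hS γ ε hγ hε₁ hε₂ hsign)
    (hrev_of_transport C hS γ ε hγ hε₁ hε₂ hsign α β hφ (fun a ha => (hA a).mp ha) hH hαγ
      (hιsign_of_hroot C hS α β hφ (fun a ha => (hA a).mp ha) hH ε hε₁ hε₂ hsign hroot)
      (pairRho C α β hφ hA hH) (pairRho_h1Top_symm C α β hφ hA hH))
    hfree t ht t' ht' hinv hinv'
  rwa [hl] at h

omit hN in
/-- **`Ker(H¹(Π^tp_{Ÿ̲̲}, l·Δ_Θ) → lim_J) ⊆ torsion` at the model** from the cyclotome fixed-point fact (`hfix`: no element of `l·Δ_Θ`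
other than `1` is fixed by `Π^tp_{Ÿ̲̲} ∩ K'` for any finite-index `K'` — finitely many roots of unity in a finite extension of `K_v`;
abc-iut-w5-d187's inflation–restriction `toLim_top_ker_torsion_of_forall_fixed_eq_one`, restated in the `coh C` spelling used by the
consumers below). [cite: NeukirchSchmidtWingberg2008, I §6] -/
theorem hker_coh_of_fixed
    (hfix : ∀ K' : Subgroup (Pi C), K'.FiniteIndex →
      ∀ a : D.lDeltaTheta l, (∀ n : Pi C, n ∈ PiYdd C ⊓ K' → MulAut.conjNormal (phi C n) a = a) → a = 1) :
    ∀ y : (coh C).H1 ⊤, (coh C).toLim ⊤ y = 0 → IsOfFinAddOrder y :=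
  toLim_top_ker_torsion_of_forall_fixed_eq_one (phi C) (D.lDeltaTheta l) (PiYdd C) hfix

end EtaleThetaDataOfSetting

/-! ### §3. At the GENUINE `θ_env` data of `X̲̲_K` (abc-iut-w4-d030's `EtaleLevels.thetaEnvData`) -/

namespace EtaleLevels

open Literature.AnabelianGeometry.EtaleTheta CohomologySystemOfContH1 EtaleThetaDataOfSetting TemperedThetaMonoids
  BadPrimeGaussianMonoids

variable {p : ℕ} [Fact p.Prime] {D : Literature.AnabelianGeometry.EtaleTheta.ThetaSetting p}
  {E : D.EtaleThetaData} {l : ℕ} (C : E.DoubleUnderline l) (hC : D.Compat) (hS : D.Sec2Hyps)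
  (hl : l.Prime) (hp2 : p ≠ 2) (hpl : p ≠ l) (hζ : ∃ ζ : D.K, IsPrimitiveRoot ζ (4 * l))
  (mods : ∀ M : ℕ+, D.CyclotomeMod l M)
  (f : contCocycles D.toTheta D.DeltaTheta C.GtpYdduu) (hf : f ∈ C.rootCocycles hC)
  (hmods : ∀ (M M' : ℕ+) (h : (M : ℕ) ∣ (M' : ℕ)) (x : D.lDeltaTheta l),
    MuN.red p M M' h ((mods M').red x) = (mods M).red x)
  (h15 : Literature.AnabelianGeometry.EtaleTheta.ThetaSetting.Prop15iii E hC) (L : C.CuspLabels)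
  (hZ : ∀ M : ℕ+, Nonempty (ModelCyclotomes.lDeltaQuot (C.rigidData (mods M) hC hS h15 L) ≃*
    Literature.IUT.HodgeTheaters.ZHat))
  (hcharY : EtaleThetaDataOfSetting.PiYddCharacteristic C)
  (hlim : Function.Bijective (rigidLimHom C hC hS hl hp2 hpl hζ mods f hf hmods h15 L hZ))
  [(EtaleThetaDataOfSetting.PiYdd C).Normal]

/-- **`horbit` AT THE GENUINE `θ_env` DATA for the pair action `pairRhoLim C α β …`** ([IUTchII] Prop 3.1 (i) p. 87 / Cor 2.8 (i)
p. 82 / Prop 2.2 (ii) p. 66): any two members of `(thetaEnvData C …).thetaIotaLim (pairRhoLim C α β …)` — the `ι`-invariants up to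
torsion, for the LIMIT action of the pair, of the image of `θ(Π^tp_{X̲̲})` in `lim_J H¹(Π^tp_{Ÿ̲̲} ∩ J, l·Δ_Θ)` — differ by a torsion
class. Inputs: (R1) the pair with `toLZ (α γ) = −1`; (R2) `hsign`, `hroot`; (R3) `hfree` (the residual of abc-iut-w4-d010's
`prop22_ii'_model`, verbatim); `hker` (`Ker(H¹ → lim_J)` torsion). The square `toLim ∘ pairRho = pairRhoLim ∘ toLim` is
abc-iut-w5-d072's `toLim_pairRho`. [cite: Mochizuki2012, Prop 3.1 (i) p.87] -/
theorem horbit_thetaEnvData_pairRhoLim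
    -- (R1) the pointed-inversion PAIR, reversing the `ℤ`-torsor
    (α : (Pi C) ≃ₜ* (Pi C)) (β : D.GtpTheta ≃ₜ* D.GtpTheta) (hφαβ : ∀ g, β (phi C g) = phi C (α g))
    (hAβ : ∀ a : D.GtpTheta, a ∈ D.lDeltaTheta l ↔ β a ∈ D.lDeltaTheta l)
    (hH : ∀ x, x ∈ PiYdd C ↔ α x ∈ PiYdd C)
    (γ ε : Pi C) (hγ : C.toLZ γ = Multiplicative.ofAdd 1) (hε₁ : (ε : D.PiTemp) ∈ D.GtpY)
    (hε₂ : (ε : D.PiTemp) ∉ D.GtpYdd) (hαγ : C.toLZ (α γ) = Multiplicative.ofAdd (-1))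
    -- (R2)(R3) [EtTh] Prop 1.4 at the class level
    (hsign : ∃ κ : ContH1 (phi C) (D.lDeltaTheta l) (PiYdd C ⊓ ⊤), κ ^ 2 = 1 ∧
      ContH1.conj (phi C) (D.lDeltaTheta l) ε (rootLiftClass C) = rootLiftClass C * κ)
    (hroot : ∃ τ₀ : Pi C, (τ₀ : D.PiTemp) ∈ D.GtpY ∧
      h1TopAut (phi C) (D.lDeltaTheta l) (PiYdd C) α β hφαβ (fun a ha => (hAβ a).mp ha) hH (rootLiftClass C) =
        ContH1.conj (phi C) (D.lDeltaTheta l) τ₀ (rootLiftClass C))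
    (hfree : ∀ m n : ℤ, IsOfFinAddOrder
      ((h1Top C).symm (Additive.ofMul (ContH1.conj (phi C) (D.lDeltaTheta l) (γ ^ m) (rootLiftClass C))) -
        (h1Top C).symm (Additive.ofMul (ContH1.conj (phi C) (D.lDeltaTheta l) (γ ^ n) (rootLiftClass C)))) →
      m = n)
    (hker : ∀ y : (coh C).H1 ⊤, (coh C).toLim ⊤ y = 0 → IsOfFinAddOrder y) :
    ∀ x ∈ (thetaEnvData C hC hS hl hp2 hpl hζ mods f hf hmods h15 L hZ hcharY hlim).thetaIotaLim (pairRhoLim C α β hφαβ hAβ hH),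
      ∀ x' ∈ (thetaEnvData C hC hS hl hp2 hpl hζ mods f hf hmods h15 L hZ hcharY hlim).thetaIotaLim
        (pairRhoLim C α β hφαβ hAβ hH), IsOfFinAddOrder (x' - x) :=
  (thetaEnvData C hC hS hl hp2 hpl hζ mods f hf hmods h15 L hZ hcharY hlim).horbit_thetaIotaLim_of_translates
    (pairRho C α β hφαβ hAβ hH) (pairRhoLim C α β hφαβ hAβ hH) (toLim_pairRho C α β hφαβ hAβ hH) hker
    (fun n => (h1Top C).symm (Additive.ofMul (ContH1.conj (phi C) (D.lDeltaTheta l) (γ ^ n) (rootLiftClass C))))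
    (orbitOne_desc_of_sign C hC hS γ ε hγ hε₁ hε₂ hsign)
    (hrev_of_transport C hS γ ε hγ hε₁ hε₂ hsign α β hφαβ (fun a ha => (hAβ a).mp ha) hH hαγ
      (hιsign_of_hroot C hS α β hφαβ (fun a ha => (hAβ a).mp ha) hH ε hε₁ hε₂ hsign hroot)
      (pairRho C α β hφαβ hAβ hH) (pairRho_h1Top_symm C α β hφαβ hAβ hH))
    hfree

/-- **`horbit` at the genuine `θ_env` data, `hker` DISCHARGED by the cyclotome fixed-point fact `hfix`** (abc-iut-w5-d187's
inflation–restriction; the same `hfix` as abc-iut-w4-d043's `cor112_ii_model`). [cite: Mochizuki2012, Prop 3.1 (i) p.87] -/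
theorem horbit_thetaEnvData_pairRhoLim_of_fixed
    -- (R1) the pointed-inversion PAIR, reversing the `ℤ`-torsor
    (α : (Pi C) ≃ₜ* (Pi C)) (β : D.GtpTheta ≃ₜ* D.GtpTheta) (hφαβ : ∀ g, β (phi C g) = phi C (α g))
    (hAβ : ∀ a : D.GtpTheta, a ∈ D.lDeltaTheta l ↔ β a ∈ D.lDeltaTheta l)
    (hH : ∀ x, x ∈ PiYdd C ↔ α x ∈ PiYdd C)
    (γ ε : Pi C) (hγ : C.toLZ γ = Multiplicative.ofAdd 1) (hε₁ : (ε : D.PiTemp) ∈ D.GtpY)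
    (hε₂ : (ε : D.PiTemp) ∉ D.GtpYdd) (hαγ : C.toLZ (α γ) = Multiplicative.ofAdd (-1))
    -- (R2)(R3) [EtTh] Prop 1.4 at the class level
    (hsign : ∃ κ : ContH1 (phi C) (D.lDeltaTheta l) (PiYdd C ⊓ ⊤), κ ^ 2 = 1 ∧
      ContH1.conj (phi C) (D.lDeltaTheta l) ε (rootLiftClass C) = rootLiftClass C * κ)
    (hroot : ∃ τ₀ : Pi C, (τ₀ : D.PiTemp) ∈ D.GtpY ∧
      h1TopAut (phi C) (D.lDeltaTheta l) (PiYdd C) α β hφαβ (fun a ha => (hAβ a).mp ha) hH (rootLiftClass C) =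
        ContH1.conj (phi C) (D.lDeltaTheta l) τ₀ (rootLiftClass C))
    (hfree : ∀ m n : ℤ, IsOfFinAddOrder
      ((h1Top C).symm (Additive.ofMul (ContH1.conj (phi C) (D.lDeltaTheta l) (γ ^ m) (rootLiftClass C))) -
        (h1Top C).symm (Additive.ofMul (ContH1.conj (phi C) (D.lDeltaTheta l) (γ ^ n) (rootLiftClass C)))) →
      m = n)
    (hfix : ∀ K' : Subgroup (Pi C), K'.FiniteIndex →
      ∀ a : D.lDeltaTheta l, (∀ n : Pi C, n ∈ PiYdd C ⊓ K' → MulAut.conjNormal (phi C n) a = a) → a = 1) :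
    ∀ x ∈ (thetaEnvData C hC hS hl hp2 hpl hζ mods f hf hmods h15 L hZ hcharY hlim).thetaIotaLim (pairRhoLim C α β hφαβ hAβ hH),
      ∀ x' ∈ (thetaEnvData C hC hS hl hp2 hpl hζ mods f hf hmods h15 L hZ hcharY hlim).thetaIotaLim
        (pairRhoLim C α β hφαβ hAβ hH), IsOfFinAddOrder (x' - x) :=
  horbit_thetaEnvData_pairRhoLim C hC hS hl hp2 hpl hζ mods f hf hmods h15 L hZ hcharY hlim α β hφαβ hAβ hH γ ε hγ hε₁ hε₂ hαγ
    hsign hroot hfree (hker_coh_of_fixed C hfix)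

section AnyConstants

variable {Iota : Type}
  (iota : Iota → ((thetaEnvData C hC hS hl hp2 hpl hζ mods f hf hmods h15 L hZ hcharY hlim).D.coh.lim ≃+
    (thetaEnvData C hC hS hl hp2 hpl hζ mods f hf hmods h15 L hZ hcharY hlim).D.coh.lim))
  {A : Type} [CommGroup A] [MulDistribMulAction (Pi C) A] [TopologicalSpace A] [RootableBy A ℕ]
  (c : CyclotomeCoefficients (phi C) (D.lDeltaTheta l) A)
  (hA : ∀ b : A, IsOpen (MulAction.stabilizer (Pi C) b : Set (Pi C)))
  (hfi : ∀ b : A, (MulAction.stabilizer (Pi C) b).FiniteIndex)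
  (O : Submonoid A)

/-- **The Cor 3.5 (ii) junction input `horb` AT THE GENUINE RECORD, DERIVED** ([IUTchII] Cor 2.8 (i) p. 82 / Prop 3.1 (i) p. 87:
«`θ^ι_env(𝕄_*)` is one `M^×_TM`-orbit»): for the record `(thetaEnvData …).toRecord (h1LimConjMulAut …) (h1LimKummerOn c hA hfi O) iota`
with ANY inversion family `iota` whose `i₀`-th member IS the limit action of the pair (`hi₀ : iota i₀ = pairRhoLim C α β …`),
`θ^{i₀}_env(𝕄_*)` is a single `M^×_TM`-orbit — abc-iut-w5-d192's `horb_toRecord_family_of_orbit` (`htors` from bijective `c` and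
`μ ⊆ O` with inverses, `hOtors`) fed with `horbit_thetaEnvData_pairRhoLim`. Inputs: (R1)(R2)(R3), `hker`, `hc`, `hOtors`.
[cite: Mochizuki2012, Cor 2.8 (i) p.82] -/
theorem horb_toRecord_pairRhoLim (hc : Function.Bijective c.hom)
    (hOtors : ∀ a : A, IsOfFinOrder a → a ∈ O ∧ a⁻¹ ∈ O)
    -- (R1) the pointed-inversion PAIR, reversing the `ℤ`-torsor
    (α : (Pi C) ≃ₜ* (Pi C)) (β : D.GtpTheta ≃ₜ* D.GtpTheta) (hφαβ : ∀ g, β (phi C g) = phi C (α g))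
    (hAβ : ∀ a : D.GtpTheta, a ∈ D.lDeltaTheta l ↔ β a ∈ D.lDeltaTheta l)
    (hH : ∀ x, x ∈ PiYdd C ↔ α x ∈ PiYdd C)
    (γ ε : Pi C) (hγ : C.toLZ γ = Multiplicative.ofAdd 1) (hε₁ : (ε : D.PiTemp) ∈ D.GtpY)
    (hε₂ : (ε : D.PiTemp) ∉ D.GtpYdd) (hαγ : C.toLZ (α γ) = Multiplicative.ofAdd (-1))
    -- (R2)(R3) [EtTh] Prop 1.4 at the class level
    (hsign : ∃ κ : ContH1 (phi C) (D.lDeltaTheta l) (PiYdd C ⊓ ⊤), κ ^ 2 = 1 ∧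
      ContH1.conj (phi C) (D.lDeltaTheta l) ε (rootLiftClass C) = rootLiftClass C * κ)
    (hroot : ∃ τ₀ : Pi C, (τ₀ : D.PiTemp) ∈ D.GtpY ∧
      h1TopAut (phi C) (D.lDeltaTheta l) (PiYdd C) α β hφαβ (fun a ha => (hAβ a).mp ha) hH (rootLiftClass C) =
        ContH1.conj (phi C) (D.lDeltaTheta l) τ₀ (rootLiftClass C))
    (hfree : ∀ m n : ℤ, IsOfFinAddOrder
      ((h1Top C).symm (Additive.ofMul (ContH1.conj (phi C) (D.lDeltaTheta l) (γ ^ m) (rootLiftClass C))) -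
        (h1Top C).symm (Additive.ofMul (ContH1.conj (phi C) (D.lDeltaTheta l) (γ ^ n) (rootLiftClass C)))) →
      m = n)
    (hker : ∀ y : (coh C).H1 ⊤, (coh C).toLim ⊤ y = 0 → IsOfFinAddOrder y)
    {i₀ : Iota} (hi₀ : iota i₀ = pairRhoLim C α β hφαβ hAβ hH)
    {θ : ((thetaEnvData C hC hS hl hp2 hpl hζ mods f hf hmods h15 L hZ hcharY hlim).toRecord
          (h1LimConjMulAut (phi C) (D.lDeltaTheta l) (PiYdd C))
          (h1LimKummerOn (phi C) (D.lDeltaTheta l) (PiYdd C) c hA hfi O) iota).H}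
    (hθ : θ ∈ ((thetaEnvData C hC hS hl hp2 hpl hζ mods f hf hmods h15 L hZ hcharY hlim).toRecord
          (h1LimConjMulAut (phi C) (D.lDeltaTheta l) (PiYdd C))
          (h1LimKummerOn (phi C) (D.lDeltaTheta l) (PiYdd C) c hA hfi O) iota).thetaEnv i₀) :
    ∀ θ' ∈ ((thetaEnvData C hC hS hl hp2 hpl hζ mods f hf hmods h15 L hZ hcharY hlim).toRecord
          (h1LimConjMulAut (phi C) (D.lDeltaTheta l) (PiYdd C))
          (h1LimKummerOn (phi C) (D.lDeltaTheta l) (PiYdd C) c hA hfi O) iota).thetaEnv i₀,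
      ∃ u ∈ ((thetaEnvData C hC hS hl hp2 hpl hζ mods f hf hmods h15 L hZ hcharY hlim).toRecord
          (h1LimConjMulAut (phi C) (D.lDeltaTheta l) (PiYdd C))
          (h1LimKummerOn (phi C) (D.lDeltaTheta l) (PiYdd C) c hA hfi O) iota).units, θ' = u * θ := by
  refine horb_toRecord_family_of_orbit C hC hS hl hp2 hpl hζ mods f hf hmods h15 L hZ hcharY hlim iota c hA hfi O hc hOtors
    ?_ hθ
  rw [hi₀]
  exact horbit_thetaEnvData_pairRhoLim C hC hS hl hp2 hpl hζ mods f hf hmods h15 L hZ hcharY hlim α β hφαβ hAβ hH γ ε hγ hε₁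
    hε₂ hαγ hsign hroot hfree hker

end AnyConstants

end EtaleLevels

end Literature.IUT.HodgeArakelov

end
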